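import Summits.AnomalousDissipation.AnomalousDissipation.Theses.MirrorVariety
import Literature.Analysis.FluidPDE.SteadyGalerkinApprox
import Literature.Analysis.FluidPDE.NSGalerkinEnstrophy2D
import Literature.Analysis.FunctionSpaces.TorusVectorParseval

/-!
# Negative knowledge for the crux `LaminarNeverLoud` (stmt-AnomalousDissipation-2988): I, power budget

Certified copy of §0–§2 of the cdisprove work file `Cruxes/LaminarNeverLoud/Disproof.lean` (refuter-cdisprove,
generation 1).  Supports stmt-AnomalousDissipation-2988; nothing here asserts a Theses decl positively; all new
definitions are notation (`modes`, `forceCoeff`, `steadySet`, `energy`, `dissipation`, and the SETS `laminarSet`,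
`admissibleSet`, `admissibleNoPosSet` — no named facts).
The crux unfolded (`laminarNeverLoud_iff`: every smooth solenoidal mean-free force has, for all budgets, a positive
admissible laminar threshold); the hypothesis `0 < ν` is decoration (`admissible_iff_noPos`); at EVERY steady Galerkin
state (any component, any dimension) the power identity `dissipation = ∑ Re⟪ĝ k, c k⟫ ≤ ‖ĝ‖₂‖c‖₂` and the resolution
bound `dissipation ≤ 4π²νN²·energy`, whence the two TRIVIAL REGIMES of the crux, both without laminarity: each fixed
resolution (`quiet_at_fixed_resolution`) and small energy `E·∫‖f‖² < ε²` uniformly in `N` (`quiet_of_small_energy`).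
The content of the crux is uniformity in `N` in the regime `ε ≤ ‖f‖₂√E`.

Maintenance note (fullbuild repair 2026-08-16): the crux `LaminarNeverLoud` (stmt-AnomalousDissipation-2988) was
DROPPED from the route `MirrorVariety` at rev 14 (item closed `moot`), so the Theses file no longer declares
`Theses.MirrorVariety.LaminarNeverLoud`.  Its typed statement (the item's signature, formerly the body of the
Theses `def`) is kept here VERBATIM as the `@[conjecture] def Negative.LaminarNeverLoud : Prop` (an open named
statement, never asserted), so that `laminarNeverLoud_iff` and the sibling files (`Isolation.not_laminarNeverLoud_iff`,
…) keep their statements unchanged (append-only).  No other declaration changed.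
-/

noncomputable section

namespace Summit.AnomalousDissipation.AnomalousDissipation.Theorems.LaminarNeverLoud.Negative

open MeasureTheory Set Filter Topology UnitAddTorus
open scoped InnerProductSpace
open Literature.Analysis.FluidPDE Literature.Analysis.FluidPDE.Torus
open Literature.Analysis.FunctionSpaces Literature.Analysis.FunctionSpaces.Torus

variable {d : Type*} [Fintype d] [DecidableEq d]

/-! ## §0 Notation: the objects of the crux -/

/-- The resolved modes at resolution `N`: the punctured frequency ball `0 < |k|² ≤ N²`. [folklore] -/
abbrev modes (d : Type*) [Fintype d] [DecidableEq d] (N : ℕ) : Finset (d → ℤ) := (freqBall N).erase 0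

/-- The force vector of the crux: the Fourier coefficients of `f` on `S`. [folklore] -/
def forceCoeff (S : Finset (d → ℤ)) (f : UnitAddTorus d → EuclideanSpace ℝ d) :
    ↥S → EuclideanSpace ℂ d :=
  fun k => mFourierCoeff (EuclideanSpace.complexify ∘ f) (k : d → ℤ)

/-- The steady Galerkin variety over all real viscosities:
`V = {(c, ν) | c real ∧ solenoidal, galerkinRHS S ν g c = 0}`. [folklore] -/
def steadySet (S : Finset (d → ℤ)) (g : ↥S → EuclideanSpace ℂ d) :
    Set ((↥S → EuclideanSpace ℂ d) × ℝ) :=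
  {z | z.1 ∈ galerkinSubspace S ∧ galerkinRHS S z.2 g z.1 = 0}

/-- Coefficient energy `∑_k ‖c k‖²` (`= ∫ |U|²` by Parseval). [folklore] -/
def energy {S : Finset (d → ℤ)} (c : ↥S → EuclideanSpace ℂ d) : ℝ := ∑ k : ↥S, ‖c k‖ ^ 2

/-- Coefficient dissipation `ν · 4π² ∑_k |k|² ‖c k‖²` (`= ν ‖∇U‖²`). [folklore] -/
def dissipation {S : Finset (d → ℤ)} (ν : ℝ) (c : ↥S → EuclideanSpace ℂ d) : ℝ :=
  ν * (4 * Real.pi ^ 2 * ∑ k : ↥S, freqNormSq (k : d → ℤ) * ‖c k‖ ^ 2)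

/-- The LAMINAR part of `V`: the points whose connected component in `V` reaches arbitrarily large
viscosity (the crux's hypothesis, as a set). [folklore] -/
def laminarSet {X : Type*} [TopologicalSpace X] (V : Set (X × ℝ)) : Set (X × ℝ) :=
  {z | ∀ Λ : ℝ, ∃ z' ∈ connectedComponentIn V z, Λ ≤ z'.2}

/-- The ADMISSIBLE laminar thresholds: `ν₀` works for the force `f` and the budgets `(E, ε)` iff at every
resolution every laminar steady Galerkin state with `0 < ν < ν₀` and `energy ≤ E` has `dissipation < ε` — the
matrix of the crux with its dummy binders `∀ S, S = … →` / `∀ V, V = … →` substituted. [folklore] -/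
def admissibleSet (f : UnitAddTorus (Fin 3) → EuclideanSpace ℝ (Fin 3)) (E ε : ℝ) : Set ℝ :=
  {ν₀ | ∀ N : ℕ, ∀ z ∈ steadySet (modes (Fin 3) N) (forceCoeff (modes (Fin 3) N) f),
    z ∈ laminarSet (steadySet (modes (Fin 3) N) (forceCoeff (modes (Fin 3) N) f)) →
      0 < z.2 → z.2 < ν₀ → energy z.1 ≤ E → dissipation z.2 z.1 < ε}

/-- OPEN CONJECTURE — **Laminar never loud** [status: open]: for every smooth solenoidal mean-free force `f` on
`𝕋³` and all budgets `E`, `ε > 0` there is a threshold `ν₀ > 0` such that at EVERY resolution `N` (modes the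
punctured ball `0 < |k|² ≤ N²`), every steady Galerkin state `(c, ν)` of the real steady variety
`V = {(c, ν) | c real solenoidal, galerkinRHS S ν ĝ c = 0}` lying in the LAMINAR connected component (the component
of `V` through it reaches arbitrarily large viscosity) with `0 < ν < ν₀` and energy `∑‖c_k‖² ≤ E` is quiet:
`ν · 4π² ∑|k|²‖c_k‖² < ε`.  Literally the registered signature of the crux `LaminarNeverLoud`
(stmt-AnomalousDissipation-2988; formerly `Theses.MirrorVariety.LaminarNeverLoud`, DROPPED from the route at rev 14
and closed `moot` — kept here under its name as an `@[conjecture] def`, CONVENTIONS §4 / D-0014: an unproved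
statement is a `Prop`, never a theorem, so that the negative-knowledge lemmas of this directory keep their subject;
use only as a hypothesis or inside `↔`/`¬`).  POSED in this project (route route-AnomalousDissipation-MirrorVariety,
2026-08-15; grounded NEW — no printed statement; planar shadow true by Alexakis–Doering 2006). [folklore] -/
@[conjecture] def LaminarNeverLoud : Prop :=
  ∀ f : UnitAddTorus (Fin 3) → EuclideanSpace ℝ (Fin 3), IsSmooth f → IsDivFree f → HasZeroMean f →
    ∀ E ε : ℝ, 0 < ε → ∃ ν₀ : ℝ, 0 < ν₀ ∧ ∀ (N : ℕ) (S : Finset (Fin 3 → ℤ)), S = (freqBall N).erase 0 →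
      ∀ V : Set ((↥S → EuclideanSpace ℂ (Fin 3)) × ℝ),
        V = {z | z.1 ∈ galerkinSubspace S ∧
          galerkinRHS S z.2 (fun k : ↥S => mFourierCoeff (EuclideanSpace.complexify ∘ f) (k : Fin 3 → ℤ))
            z.1 = 0} →
        ∀ z ∈ V, (∀ Λ : ℝ, ∃ z' ∈ connectedComponentIn V z, Λ ≤ z'.2) → 0 < z.2 → z.2 < ν₀ →
          ∑ k : ↥S, ‖z.1 k‖ ^ 2 ≤ E →
            z.2 * (4 * Real.pi ^ 2 * ∑ k : ↥S, freqNormSq (k : Fin 3 → ℤ) * ‖z.1 k‖ ^ 2) < ε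

/-- **The crux unfolded**: `LaminarNeverLoud` says every smooth solenoidal mean-free force admits, for all budgets,
a positive admissible laminar threshold (pure bookkeeping). [folklore] -/
theorem laminarNeverLoud_iff : LaminarNeverLoud ↔
    ∀ f : UnitAddTorus (Fin 3) → EuclideanSpace ℝ (Fin 3), IsSmooth f → IsDivFree f → HasZeroMean f →
      ∀ E ε : ℝ, 0 < ε → ∃ ν₀ ∈ admissibleSet f E ε, 0 < ν₀ := by
  constructor
  · intro h f hf hdiv hmean E ε hε
    obtain ⟨ν₀, hν₀, H⟩ := h f hf hdiv hmean E ε hε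
    exact ⟨ν₀, fun N z hz hlam => H N _ rfl _ rfl z hz hlam, hν₀⟩
  · intro h f hf hdiv hmean E ε hε
    obtain ⟨ν₀, H, hν₀⟩ := h f hf hdiv hmean E ε hε
    refine ⟨ν₀, hν₀, ?_⟩
    rintro N S rfl V rfl z hz hlam
    exact H N z hz hlam

/-! ## §1 A hypothesis that carries no load: `0 < ν` -/

/-- Admissible thresholds with the hypothesis `0 < z.2` deleted. [folklore] -/
def admissibleNoPosSet (f : UnitAddTorus (Fin 3) → EuclideanSpace ℝ (Fin 3)) (E ε : ℝ) : Set ℝ :=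
  {ν₀ | ∀ N : ℕ, ∀ z ∈ steadySet (modes (Fin 3) N) (forceCoeff (modes (Fin 3) N) f),
    z ∈ laminarSet (steadySet (modes (Fin 3) N) (forceCoeff (modes (Fin 3) N) f)) →
      z.2 < ν₀ → energy z.1 ≤ E → dissipation z.2 z.1 < ε}

omit [DecidableEq d] in
/-- The enstrophy sum is nonnegative. [folklore] -/
theorem enstrophySum_nonneg {S : Finset (d → ℤ)} (c : ↥S → EuclideanSpace ℂ d) :
    0 ≤ ∑ k : ↥S, freqNormSq (k : d → ℤ) * ‖c k‖ ^ 2 :=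
  Finset.sum_nonneg fun _ _ => mul_nonneg (freqNormSq_nonneg _) (sq_nonneg _)

omit [DecidableEq d] in
/-- The energy is nonnegative. [folklore] -/
theorem energy_nonneg {S : Finset (d → ℤ)} (c : ↥S → EuclideanSpace ℂ d) : 0 ≤ energy c :=
  Finset.sum_nonneg fun _ _ => sq_nonneg _

omit [DecidableEq d] in
/-- Dissipation is nonpositive at nonpositive viscosity. [folklore] -/
theorem dissipation_nonpos_of_nonpos {S : Finset (d → ℤ)} {ν : ℝ} (hν : ν ≤ 0)
    (c : ↥S → EuclideanSpace ℂ d) : dissipation ν c ≤ 0 := by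
  have h := enstrophySum_nonneg c
  unfold dissipation
  exact mul_nonpos_of_nonpos_of_nonneg hν (by positivity)

omit [DecidableEq d] in
/-- Dissipation is nonnegative at nonnegative viscosity. [folklore] -/
theorem dissipation_nonneg_of_nonneg {S : Finset (d → ℤ)} {ν : ℝ} (hν : 0 ≤ ν)
    (c : ↥S → EuclideanSpace ℂ d) : 0 ≤ dissipation ν c := by
  have h := enstrophySum_nonneg c
  unfold dissipation
  positivity

/-- **`0 < ν` is decoration**: at `ν ≤ 0` the dissipation is `≤ 0 < ε`, so admissibility is the same with
the sign hypothesis deleted — the crux quantifies in effect over ALL laminar points with `ν < ν₀`.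
(Information for the prover: nothing about the sign of `ν` can be used.) [folklore] -/
theorem admissible_iff_noPos {f : UnitAddTorus (Fin 3) → EuclideanSpace ℝ (Fin 3)} {E ε ν₀ : ℝ}
    (hε : 0 < ε) : ν₀ ∈ admissibleSet f E ε ↔ ν₀ ∈ admissibleNoPosSet f E ε := by
  constructor
  · intro H N z hz hlam hlt hE
    rcases le_or_gt z.2 0 with hle | hpos
    · exact (dissipation_nonpos_of_nonpos hle z.1).trans_lt hε
    · exact H N z hz hlam hpos hlt hE
  · intro H N z hz hlam _ hlt hE
    exact H N z hz hlam hlt hE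

/-! ## §2 What holds at EVERY steady Galerkin state (any component, any dimension) -/

/-- Symmetry of the punctured ball. [folklore] -/
theorem modes_symm (N : ℕ) : ∀ k ∈ modes d N, -k ∈ modes d N := by
  intro k hk
  have hk' := Finset.mem_erase.1 hk
  exact Finset.mem_erase.2 ⟨neg_ne_zero.2 hk'.1, neg_mem_freqBall.2 hk'.2⟩

/-- The mean mode is not resolved. [folklore] -/
theorem zero_not_mem_modes (N : ℕ) : (0 : d → ℤ) ∉ modes d N := fun h =>
  (Finset.mem_erase.1 h).1 rfl

/-- On the punctured ball `|k|² ≤ N²`. [folklore] -/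
theorem freqNormSq_le_of_mem_modes {N : ℕ} {k : d → ℤ} (hk : k ∈ modes d N) :
    freqNormSq k ≤ (N : ℝ) ^ 2 :=
  mem_freqBall.1 (Finset.mem_erase.1 hk).2

omit [DecidableEq d] in
/-- The force vector of an integrable real field is a real coefficient vector. [folklore] -/
theorem isRealCoeff_forceCoeff (S : Finset (d → ℤ)) {f : UnitAddTorus d → EuclideanSpace ℝ d}
    (hf : Integrable f volume) : IsRealCoeff (forceCoeff S f) :=
  isRealCoeff_mFourierCoeff hf

/-- **The power identity** at a steady Galerkin state: `ν‖∇U‖² = (G, U)`, in coefficients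
`dissipation ν c = ∑_k Re⟪g k, c k⟫` (Temam 1979 Ch. II (1.29); the tree's
`galerkin_energy_eq_of_galerkinRHS_eq_zero` + Parseval). [cite: Temam1979, Ch. II Thm. 1.2 (1.29)] -/
theorem dissipation_eq_power {S : Finset (d → ℤ)} (hS : ∀ k ∈ S, -k ∈ S) {ν : ℝ}
    {g c : ↥S → EuclideanSpace ℂ d} (hg : IsRealCoeff g) (hc : c ∈ galerkinSubspace S)
    (h0 : galerkinRHS S ν g c = 0) :
    dissipation ν c = ∑ k : ↥S, (inner ℂ (g k) (c k)).re := by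
  have h := galerkin_energy_eq_of_galerkinRHS_eq_zero ν hS hg hc h0
  rw [integral_inner_realTrigPoly_realTrigPoly hS (hg.isConjSymm_coeffExt hS)
      (hc.1.isConjSymm_coeffExt hS), ← Finset.sum_coe_sort,
    toReal_eGradNormSq_realTrigPoly hS (hc.1.isConjSymm_coeffExt hS),
    sum_coeffExt (fun k v => freqNormSq k * ‖v‖ ^ 2)] at h
  rw [dissipation, h]
  exact Finset.sum_congr rfl fun k _ => by rw [coeffExt_coe, coeffExt_coe]

/-- **The power bound**: `dissipation ν c ≤ ‖g‖₂ ‖c‖₂ = √(energy g) √(energy c)` at every steady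
Galerkin state (Cauchy–Schwarz on the power identity). [folklore] -/
theorem dissipation_le_sqrt_mul_sqrt {S : Finset (d → ℤ)} (hS : ∀ k ∈ S, -k ∈ S) {ν : ℝ}
    {g c : ↥S → EuclideanSpace ℂ d} (hg : IsRealCoeff g) (hc : c ∈ galerkinSubspace S)
    (h0 : galerkinRHS S ν g c = 0) :
    dissipation ν c ≤ Real.sqrt (energy g) * Real.sqrt (energy c) := by
  have h := galerkin_energy_eq_of_galerkinRHS_eq_zero ν hS hg hc h0
  have hle := integral_inner_realTrigPoly_coeffExt_le hS hg hc.1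
  rw [← h, toReal_eGradNormSq_realTrigPoly hS (hc.1.isConjSymm_coeffExt hS),
    sum_coeffExt (fun k v => freqNormSq k * ‖v‖ ^ 2)] at hle
  exact hle

/-- **The resolution bound**: on the punctured ball of radius `N`, `dissipation ν c ≤ ν 4π² N² energy c`
for `ν ≥ 0` (Bernstein). This is why the crux is trivial at each fixed `N`. [folklore] -/
theorem dissipation_le_resolution {N : ℕ} {ν : ℝ} (hν : 0 ≤ ν)
    (c : ↥(modes d N) → EuclideanSpace ℂ d) :
    dissipation ν c ≤ ν * (4 * Real.pi ^ 2 * ((N : ℝ) ^ 2 * energy c)) := by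
  unfold dissipation energy
  refine mul_le_mul_of_nonneg_left (mul_le_mul_of_nonneg_left ?_ (by positivity)) hν
  rw [Finset.mul_sum]
  exact Finset.sum_le_sum fun k _ =>
    mul_le_mul_of_nonneg_right (freqNormSq_le_of_mem_modes k.2) (sq_nonneg _)

/-- **FIXED RESOLUTION IS TRIVIAL** (the docstring's "trivial at each fixed N (ν N² E)", certified, and
for EVERY steady state — no laminarity, no smoothness, any force vector): at resolution `N`,
`ν₀ = ε / (4π² N² E⁺ + 1)` works. The content of the crux is uniformity of `ν₀` in `N`. [folklore] -/
theorem quiet_at_fixed_resolution (N : ℕ) (g : ↥(modes d N) → EuclideanSpace ℂ d) (E ε : ℝ)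
    (hε : 0 < ε) : ∃ ν₀ : ℝ, 0 < ν₀ ∧ ∀ z ∈ steadySet (modes d N) g,
      0 < z.2 → z.2 < ν₀ → energy z.1 ≤ E → dissipation z.2 z.1 < ε := by
  set K : ℝ := 4 * Real.pi ^ 2 * ((N : ℝ) ^ 2 * max E 0) with hK
  have hK0 : 0 ≤ K := by positivity
  refine ⟨ε / (K + 1), div_pos hε (by linarith), fun z _ hpos hlt hE => ?_⟩
  have h1 := dissipation_le_resolution hpos.le z.1
  have h2 : z.2 * (4 * Real.pi ^ 2 * ((N : ℝ) ^ 2 * energy z.1)) ≤ z.2 * K := by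
    refine mul_le_mul_of_nonneg_left ?_ hpos.le
    exact mul_le_mul_of_nonneg_left (mul_le_mul_of_nonneg_left (hE.trans (le_max_left _ _))
      (sq_nonneg _)) (by positivity)
  have h3 : z.2 * K ≤ z.2 * (K + 1) := by nlinarith
  have h4 : z.2 * (K + 1) < ε / (K + 1) * (K + 1) := mul_lt_mul_of_pos_right hlt (by linarith)
  rw [div_mul_cancel₀ _ (by linarith : K + 1 ≠ 0)] at h4
  linarith

omit [DecidableEq d] in
/-- Bessel for the force vector: `energy (forceCoeff S f) ≤ ∫ ‖f‖²`. [folklore] -/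
theorem energy_forceCoeff_le (S : Finset (d → ℤ)) {f : UnitAddTorus d → EuclideanSpace ℝ d}
    (hf : MemLp f 2 volume) : energy (forceCoeff S f) ≤ ∫ x, ‖f x‖ ^ 2 := by
  have h := sum_le_hasSum S (fun k _ => sq_nonneg _) (hasSum_sq_norm_mFourierCoeff_complexify hf)
  rw [← Finset.sum_coe_sort] at h
  exact h

/-- **SMALL ENERGY IS TRIVIAL, UNIFORMLY IN `N`** (and for every steady state, laminar or not, at every
viscosity): if `E · ∫‖f‖² < ε²` then every steady Galerkin state with `energy ≤ E` has
`dissipation < ε`, because `dissipation = (G,U) ≤ ‖f‖₂ √E`. So the crux has content only in the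
regime `ε ≤ ‖f‖₂ √E` — loudness is capped by the power the force can inject at energy `E`. [folklore] -/
theorem quiet_of_small_energy {f : UnitAddTorus d → EuclideanSpace ℝ d} (hf : MemLp f 2 volume)
    {E ε : ℝ} (hε : 0 < ε) (hE : E * ∫ x, ‖f x‖ ^ 2 < ε ^ 2) (N : ℕ) :
    ∀ z ∈ steadySet (modes d N) (forceCoeff (modes d N) f),
      energy z.1 ≤ E → dissipation z.2 z.1 < ε := by
  intro z hz hzE
  have hS := modes_symm (d := d) N
  have hg : IsRealCoeff (forceCoeff (modes d N) f) :=
    isRealCoeff_forceCoeff _ (hf.integrable one_le_two)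
  have h1 := dissipation_le_sqrt_mul_sqrt hS hg hz.1 hz.2
  have hF0 : 0 ≤ ∫ x, ‖f x‖ ^ 2 := integral_nonneg fun x => sq_nonneg _
  have hen0 : 0 ≤ energy z.1 := Finset.sum_nonneg fun k _ => sq_nonneg _
  have hE0 : 0 ≤ E := hen0.trans hzE
  have h2 : Real.sqrt (energy (forceCoeff (modes d N) f)) * Real.sqrt (energy z.1) ≤
      Real.sqrt (∫ x, ‖f x‖ ^ 2) * Real.sqrt E :=
    mul_le_mul (Real.sqrt_le_sqrt (energy_forceCoeff_le _ hf)) (Real.sqrt_le_sqrt hzE)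
      (Real.sqrt_nonneg _) (Real.sqrt_nonneg _)
  have h3 : Real.sqrt (∫ x, ‖f x‖ ^ 2) * Real.sqrt E < ε := by
    rw [← Real.sqrt_mul hF0, mul_comm]
    calc Real.sqrt (E * ∫ x, ‖f x‖ ^ 2) < Real.sqrt (ε ^ 2) :=
          Real.sqrt_lt_sqrt (mul_nonneg hE0 hF0) hE
      _ = ε := Real.sqrt_sq hε.le
  linarith

end Summit.AnomalousDissipation.AnomalousDissipation.Theorems.LaminarNeverLoud.Negative
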